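import Summits.BirchSwinnertonDyer.BirchSwinnertonDyer.Theorems.SchneiderFreeAdditiveX3SemistableTwistLocalThree
import Summits.BirchSwinnertonDyer.BirchSwinnertonDyer.Theorems.SchneiderFreeAdditiveX3KYLambdaAlgCharRelaxationOfPrintFiveLe
import Summits.BirchSwinnertonDyer.BirchSwinnertonDyer.Theorems.SchneiderFreeAdditiveX3KYMuZeroOfPrintFiveLe
import HarnessLib

/-!
# Route `SchneiderFreeAdditiveX3` (K1 door): generations 23–24's PUBLISHED-FACT road ([INV.μ] + `Λ`-torsion from CGLS Prop. 14,
# Keller–Yin Thm. 1.4.1's `λ`-count, CGLS's character relaxation, the door inequality) ON THE (G-ord, `e = 2`) CELL AT EVERY ODD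
# `p` — in particular `p = 3` — FOR THE PAIRS WITH A NON-ANOMALOUS TWIST

Cell `bsd-schneider-ideate`, seat `bsd-schneider-door-c5` (prover, generation 25; assembly layer; `--supports` 19177).
PARTITION: board row B6 ∩ X3 ∩ sst-twist, `r = 1` (7 101 pairs; (G-ord, `e = 2`) half 2 560, of which 2 411 at `p = 3`) of
`Rank1Residual.partition`; types-the-object-of nothing new; EXTENDS the `p ≥ 5` cell forms of generations 23–24 (149 (G-ord)
census pairs) to the 686 NON-ANOMALOUS (G-ord) pairs at `p = 3` (kit j319291: `a_3(E^{(−3)}) ≡ 2 (mod 3)`); closes none of B6's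
cells (BSD NOT advanced). bears_on: K1-door (items 18971/18972 → 19177 r3) + K1-wing (20365).

WHAT.  Every theorem of the road `…KYMuZeroOfPrintFiveLe` (F3), `…KYLambdaAlgImprimitive{,Eq}OfPrintFiveLe` (B1/B2),
`…KYLambdaAlgCharRelaxationOfPrintFiveLe` (C) has a REDUCTION-TYPE-FREE form `_of_nonAnomalous` whose only local input is the
clause `hna` («no `D_𝔓`, `𝔓 ∣ p`, fixes a line of `E[p]` pointwise or acts trivially on its quotient»), and a cell form at `p ≥ 5`
where `hna` comes from inertia (`ω^{(p±1)/2} ∉ {1, ω}`).  `…SemistableTwistLocalThree` supplies `hna` at EVERY odd `p` for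
`W = C • V^{(p*)}` with `V` good ordinary and `a_p(V) ≢ 1 (mod p)` (Frobenius of the twist + `det = χ̄_p` + `√p* ∈ ℚ(ζ_p)`).  This
file writes the corresponding cell forms under the census-checkable per-pair clause

  `NAT(W, p)`: every globally minimal good-ordinary `p*`-twist model `V` of `W` (`W = C • V^{(p*)}`) has `p ∤ a_p(V) − 1`

(spelled out as a `∀ V C, …` binder; all such `V` are `ℚ`-isomorphic, so this is ONE number per pair), on the door's cell
`ClassX3 W p ∧ SubGordTwo W p`, `2 < p`:
* §1 `hna` in both shapes (rational lines / every subgroup of order `p`);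
* §2 [INV.μ] + `Λ`-torsion of `X_ac^∅(E_K)` ⟸ CGLS22 Prop. 14 [PUBLISHED] (F3 §1) — at `p = 3` this REPLACES the preprint
  character sentence `prop125_residualCharacterUnrSelmer_finite_OPEN` for the 686 pairs;
* §3 `X_ac^{Sf}` f.g. / torsion / `μ = 0` (B2 §3); §4 `λ(X_ac^{Sf}(E_K)) = λ(Dsub.X) + λ(Dquot.X)` mod 8 PUB (B2 §4);
* §5 the door's primitive dual: generic `_of_nonAnomalous` form of B2 §5 (`λ(X_ac^∅) + corank = λ_sub + λ_quot`) + cell form;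
* §6 generic `_of_nonAnomalous` forms of C §8–§9 and the cell forms: `λ(𝔛_{θsub}) + λ(𝔛_{θquot}) + ΣΣ λ𝒫_w(θ) ≤ λ(X_ac^∅(E_K)) +
  Σ_{w∈Sf} λ𝒫_w(E_K)` mod 10 PUB — the DOOR INEQUALITY at `p = 3` for the non-anomalous pairs.

HONEST FRAMING: one-line compositions of tree theorems, CONDITIONAL BY NAME on published facts typed as `Prop`s (CGLS22 Prop.
1.2.5 / 14 / Cor. 1.2.6; Greenberg 2016 4.1.1 / 2.6.3; Greenberg 2006 4.1 / 4.2 / §5A / 3.2 — none introduced here); no definition,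
no named fact, no `sorry`; nothing analytic, nothing for the ANOMALOUS pairs (1 725 of 2 411 at `p = 3`), nothing about BSD or a
main conjecture is asserted; «closes rung: none».  References: CGLS, Invent. Math. 227 (2022) §1.2, §1.4 [CastellaGrossiLeeSkinner2022];
Keller–Yin arXiv:2402.12781 Thm. 1.4.1 [KellerYin2024]; arXiv:2410.23241 §3.5 [KellerYin2024b]; Greenberg–Vatsal 2000 §2
[GreenbergVatsal2000]; Serre 1972 §1.11 [Serre1972]; Mazur 1972 §1 [Mazur1972]; the generation 23/24/25 files named above.
-/

set_option autoImplicit false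
set_option linter.dupNamespace false -- the summit namespace `…BirchSwinnertonDyer.BirchSwinnertonDyer.Theorems` (Sub = Summit, D-0017) trips it

noncomputable section

open scoped Classical Pointwise NumberField

open WeierstrassCurve NumberField IsDedekindDomain Field
  Literature.NumberTheory.EllipticCurves Literature.NumberTheory.EllipticCurves.IwasawaAlgebra
  Literature.NumberTheory.EllipticCurves.GreenbergSelmer
  Literature.NumberTheory.EllipticCurves.GreenbergVatsal2000
  Literature.NumberTheory.GaloisRepresentations IsDedekindDomain.HeightOneSpectrum
  Literature.NumberTheory.EllipticCurves.Rank1Residual Literature.NumberTheory.EllipticCurves.KellerYin2024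
  Literature.NumberTheory.EllipticCurves.IwasawaDual Literature.NumberTheory.EllipticCurves.Castella2018.AcSelmer
  Literature.NumberTheory.IwasawaTheory Literature.NumberTheory.IwasawaTheory.Greenberg2016
  Literature.NumberTheory.IwasawaTheory.Greenberg2006
  Summit.BirchSwinnertonDyer.Rank1Residual Summit.BirchSwinnertonDyer.Rank1Residual.Additive
  Summit.BirchSwinnertonDyer.Rank1Residual.X2.ResidualDevissageModules
  Summit.BirchSwinnertonDyer.BirchSwinnertonDyer.Theorems
  Summit.BirchSwinnertonDyer.BirchSwinnertonDyer.Theorems.SchneiderFreeAdditiveX3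
  Summit.BirchSwinnertonDyer.BirchSwinnertonDyer.Theorems.SchneiderFreeAdditiveX3.KYLambdaAlg
  Summit.BirchSwinnertonDyer.BirchSwinnertonDyer.Theorems.SchneiderFreeAdditiveX3.KYLambdaAlgChar
  Summit.BirchSwinnertonDyer.BirchSwinnertonDyer.Theorems.SchneiderFreeAdditiveX3.KYMuZeroOfPrint
  Summit.BirchSwinnertonDyer.BirchSwinnertonDyer.Theorems.SchneiderFreeAdditiveX3.SemistableTwistLocalThree
open Literature.NumberTheory.EllipticCurves.CastellaGrossiLeeSkinner2022
  (cor126_residualCharacter_globalLift cor126_residualCharacter_localSurjective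
    prop125_characterGrSelmerDual_torsion_muZero_dim prop14_residualCharacterSelmer_finite)

namespace Summit.BirchSwinnertonDyer.BirchSwinnertonDyer.Theorems.SchneiderFreeAdditiveX3.KYNonAnomalousTwist

variable {p : ℕ} [hp : Fact p.Prime]

/-! ### §1 The non-anomalous clause on the (G-ord, `e = 2`) cell under `NAT(W, p)`, both shapes -/

/-- **`hna`, rational-line shape, every odd `p`:** on `ClassX3 W p ∧ SubGordTwo W p` with `NAT(W, p)`, for every place `v ∋ p`,
every rational line `Φ ≤ W[p]` and every `𝔓 ∣ v`, `D_𝔓` neither fixes `Φ` pointwise nor acts trivially on `W[p]/Φ`.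
[cite: Serre1972, §1.11 (1) and Prop. 11] [cite: SilvermanAEC2009, X.5 Cor. 5.4] [cite: Mazur1972, §1] -/
theorem hna_isRationalLine_of_subGordTwo_of_forall_twist (W : WeierstrassCurve ℚ) [W.IsElliptic] [W.IsGloballyMinimal]
    (hp2 : 2 < p) (hX : ClassX3 W p) (hSG : SubGordTwo W p)
    (htw : ∀ (V : WeierstrassCurve ℚ) [V.IsElliptic] [V.IsGloballyMinimal] (C : VariableChange ℚ),
      GoodOrd V p → C • V.quadraticTwist ((-1 : ℚ) ^ (p / 2) * p) = W → ¬ (p : ℤ) ∣ V.frobeniusTrace p - 1) :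
    ∀ (v : HeightOneSpectrum (𝓞 ℚ)), ((p : ℕ) : 𝓞 ℚ) ∈ v.asIdeal →
      ∀ (Φ : AddSubgroup (geomTorsion W (p : ℤ))), IsRationalLine W p Φ →
      ∀ 𝔓 ∈ v.primesAbove,
        (¬ ∀ g ∈ 𝔓.decompositionSubgroup (absoluteGaloisGroup ℚ), ∀ P ∈ Φ, g • P = P) ∧
          (¬ ∀ g ∈ 𝔓.decompositionSubgroup (absoluteGaloisGroup ℚ),
            ∀ P : geomTorsion W (p : ℤ), g • P - P ∈ Φ) :=
  fun _ hpv _ hΦ _ h𝔓 ↦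
    not_fix_and_not_quot_of_classX3_of_subGordTwo_of_forall_twist W p hp2.ne' hX hSG htw hpv h𝔓 hΦ.1

/-- **`hna`, every subgroup of order `p`, every odd `p`** (the shape consumed by B1/B2/C). [cite: Serre1972, §1.11]
[cite: SilvermanAEC2009, X.5 Cor. 5.4] [cite: CastellaGrossiLeeSkinner2022, §1.2 (hypothesis θ|_{G_v̄} ≠ 𝟙, ω)] -/
theorem hna_card_of_subGordTwo_of_forall_twist (W : WeierstrassCurve ℚ) [W.IsElliptic] [W.IsGloballyMinimal]
    (hp2 : 2 < p) (hX : ClassX3 W p) (hSG : SubGordTwo W p)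
    (htw : ∀ (V : WeierstrassCurve ℚ) [V.IsElliptic] [V.IsGloballyMinimal] (C : VariableChange ℚ),
      GoodOrd V p → C • V.quadraticTwist ((-1 : ℚ) ^ (p / 2) * p) = W → ¬ (p : ℤ) ∣ V.frobeniusTrace p - 1) :
    ∀ (v : HeightOneSpectrum (𝓞 ℚ)), ((p : ℕ) : 𝓞 ℚ) ∈ v.asIdeal →
      ∀ (Φ : AddSubgroup (geomTorsion W (p : ℤ))), Nat.card Φ = p →
      ∀ 𝔓 ∈ v.primesAbove,
        (¬ ∀ g ∈ 𝔓.decompositionSubgroup (absoluteGaloisGroup ℚ), ∀ P ∈ Φ, g • P = P) ∧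
          (¬ ∀ g ∈ 𝔓.decompositionSubgroup (absoluteGaloisGroup ℚ),
            ∀ P : geomTorsion W (p : ℤ), g • P - P ∈ Φ) :=
  fun _ hpv _ hΦ _ h𝔓 ↦
    not_fix_and_not_quot_of_classX3_of_subGordTwo_of_forall_twist W p hp2.ne' hX hSG htw hpv h𝔓 hΦ

/-! ### §2 [INV.μ] and the `Λ`-torsion clause from CGLS22 Prop. 14 [PUB], every odd `p` (new: `p = 3`) -/

/-- **On the (G-ord, `e = 2`) cell with `NAT(W, p)`, `2 < p`: `X_ac^∅(E_K[p^∞])` is `Λ`-torsion with `μ = 0` ⟸ CGLS22 Prop. 14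
(PUBLISHED)** — for every Heegner `K` for `N_W` with `(p)` split, `v̄ ∋ p`, THE anticyclotomic `κ`, a generator `γ`.  F3 §1
(`isTorsion_muInvariant_eq_zero_empty_of_prop14_of_nonAnomalous`) with §1's `hna`.  At `p = 3` these clauses of Keller–Yin
arXiv:2410.23241 Thms. 3.3.6 / 3.5.1 thereby rest on a refereed theorem for the 686 non-anomalous pairs (census kit j319291),
instead of the preprint sentence `prop125…_OPEN`.  CONDITIONAL on `hfact`; nothing asserted about BSD.
[cite: CastellaGrossiLeeSkinner2022, §1.2 Prop. 14, §1.4 Props. 17–18 (arXiv:2008.02571; Invent. Math. 227 (2022))]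
[cite: KellerYin2024b, Thm. 3.3.6 clause "Λ-torsion" and Thm. 3.5.1 clause "μ(𝔛) = 0" (arXiv:2410.23241 pp. 19–20) (preprint; derived here for odd p under NAT)] -/
theorem isTorsion_muInvariant_eq_zero_empty_of_prop14_of_subGordTwo_of_forall_twist
    (hfact : prop14_residualCharacterSelmer_finite)
    (W : WeierstrassCurve ℚ) [W.IsElliptic] [W.IsGloballyMinimal]
    (K : Type) [Field K] [NumberField K] (vbar : HeightOneSpectrum (𝓞 K))
    (κ : ZpExtension K p) (γ : absoluteGaloisGroup K) [Fact (κ.IsTopGenerator γ)]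
    (hp2 : 2 < p) (hX : ClassX3 W p) (hSG : SubGordTwo W p)
    (htw : ∀ (V : WeierstrassCurve ℚ) [V.IsElliptic] [V.IsGloballyMinimal] (C : VariableChange ℚ),
      GoodOrd V p → C • V.quadraticTwist ((-1 : ℚ) ^ (p / 2) * p) = W → ¬ (p : ℤ) ∣ V.frobeniusTrace p - 1)
    (hK : IsImaginaryQuadratic K) (hH : SatisfiesHeegnerHypothesis (W.conductorNorm ℤ) K)
    (hsplit : ((Ideal.span {(p : ℤ)}).primesOver (𝓞 K)).ncard = 2)
    (hvbar : ((p : ℕ) : 𝓞 K) ∈ vbar.asIdeal) (hκ : κ.IsAnticyclotomic) :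
    Module.IsTorsion (IwasawaAlgebra p) (XAc (W.baseChange K) p κ vbar ∅ γ) ∧
      muInvariant p (XAc (W.baseChange K) p κ vbar ∅ γ) = 0 :=
  isTorsion_muInvariant_eq_zero_empty_of_prop14_of_nonAnomalous hfact W K vbar κ γ hp2 hX.1 hK hH hsplit hvbar hκ
    (hna_isRationalLine_of_subGordTwo_of_forall_twist W hp2 hX hSG htw)

/-! ### §3 `X_ac^{Sf}` f.g., `Λ`-torsion, `μ = 0` from CGLS22 Prop. 14 [PUB] -/

/-- **On the (G-ord, `e = 2`) cell with `NAT(W, p)`, `2 < p`: `X_ac^{Sf}(E_K)` is f.g., `Λ`-torsion, `μ = 0` ⟸ CGLS22 Prop. 14 [PUB]**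
(B2 §3 `xAc_moduleFinite_isTorsion_muInvariant_of_prop14_of_nonAnomalous` with §1's `hna`; `Sf` = places of `K` over `N_W` off `p`).
[cite: CastellaGrossiLeeSkinner2022, §1.2 Prop. 14 (arXiv:2008.02571)] [cite: Castella2018, Def. 2.2] -/
theorem xAc_moduleFinite_isTorsion_muInvariant_of_prop14_of_subGordTwo_of_forall_twist
    (hfact : prop14_residualCharacterSelmer_finite)
    (W : WeierstrassCurve ℚ) [W.IsElliptic] [W.IsGloballyMinimal]
    (K : Type) [Field K] [NumberField K] (vbar : HeightOneSpectrum (𝓞 K))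
    (κ : ZpExtension K p) (γ : absoluteGaloisGroup K) [Fact (κ.IsTopGenerator γ)]
    (Sf : Finset (HeightOneSpectrum (𝓞 K)))
    (hp2 : 2 < p) (hX : ClassX3 W p) (hSG : SubGordTwo W p)
    (htw : ∀ (V : WeierstrassCurve ℚ) [V.IsElliptic] [V.IsGloballyMinimal] (C : VariableChange ℚ),
      GoodOrd V p → C • V.quadraticTwist ((-1 : ℚ) ^ (p / 2) * p) = W → ¬ (p : ℤ) ∣ V.frobeniusTrace p - 1)
    (hK : IsImaginaryQuadratic K) (hH : SatisfiesHeegnerHypothesis (W.conductorNorm ℤ) K)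
    (hsplit : ((Ideal.span {(p : ℤ)}).primesOver (𝓞 K)).ncard = 2)
    (hvbar : ((p : ℕ) : 𝓞 K) ∈ vbar.asIdeal) (hκ : κ.IsAnticyclotomic)
    (hSf : ∀ w : HeightOneSpectrum (𝓞 K), w ∈ Sf ↔
      (((W.conductorNorm ℤ : ℤ) : 𝓞 K) ∈ w.asIdeal ∧ ((p : ℕ) : 𝓞 K) ∉ w.asIdeal)) :
    Module.Finite (IwasawaAlgebra p) (XAc (W.baseChange K) p κ vbar (↑Sf : Set (HeightOneSpectrum (𝓞 K))) γ) ∧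
      Module.IsTorsion (IwasawaAlgebra p) (XAc (W.baseChange K) p κ vbar (↑Sf : Set (HeightOneSpectrum (𝓞 K))) γ) ∧
      muInvariant p (XAc (W.baseChange K) p κ vbar (↑Sf : Set (HeightOneSpectrum (𝓞 K))) γ) = 0 :=
  xAc_moduleFinite_isTorsion_muInvariant_of_prop14_of_nonAnomalous hfact W K vbar κ γ Sf hp2 hX.1 hK hH hsplit hvbar hκ hSf
    (hna_card_of_subGordTwo_of_forall_twist W hp2 hX hSG htw)

/-! ### §4 Keller–Yin Thm. 1.4.1's `λ`-identity with equality, modulo 8 PUB -/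

/-- **On the (G-ord, `e = 2`) cell with `NAT(W, p)`, `2 < p = v v̄`: `λ(X_ac^{Sf}(E_K)) = λ(𝔛^{Sf}_{Gr}(θsub)) + λ(𝔛^{Sf}_{Gr}(θquot))`
for EVERY residual pair of `E_K[p]` and all strict dual data, modulo the eight published facts** (B2 §4
`lambdaInvariant_xAc_eq_add_of_nonAnomalous_of_facts` with §1's `hna`).  Keller–Yin 2410.23241 §3.5's "exactly as in [KY24]",
imprimitive currency, now also at `p = 3` for the non-anomalous pairs.
[cite: KellerYin2024b, §3.5 first paragraph and Thm. 3.5.1 first sentence (arXiv:2410.23241 p. 20) (preprint; algebraic λ-clause derived for odd p under NAT)]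
[cite: KellerYin2024, Thm. 1.4.1 (arXiv:2402.12781v2 TeX L1087–1098)]
[cite: CastellaGrossiLeeSkinner2022, §1.2 Prop. 1.2.5, Prop. 14, Cor. 1.2.6, §1.4 Props. 1.4.1–1.4.2, Cor. 1.4.3]
[cite: Greenberg2016Selmer, Prop. 4.1.1 (c)] [cite: Greenberg2006, Props. 3.2, 4.1, 4.2] -/
theorem lambdaInvariant_xAc_eq_add_of_subGordTwo_of_forall_twist_of_facts
    (hprop125 : prop125_characterGrSelmerDual_torsion_muZero_dim) (hfact : prop14_residualCharacterSelmer_finite)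
    (hlift : cor126_residualCharacter_globalLift) (hlocal : cor126_residualCharacter_localSurjective)
    (h411 : prop411_selmer_isAlmostDivisible) (h41 : prop41_globalEulerPoincareCorank)
    (h42 : prop42_localEulerPoincareCorank) (h32 : prop32_cohomology_isCofinitelyGenerated)
    (W : WeierstrassCurve ℚ) [W.IsElliptic] [W.IsGloballyMinimal]
    (K : Type) [Field K] [NumberField K] {v : HeightOneSpectrum (𝓞 K)} (vbar : HeightOneSpectrum (𝓞 K))
    (κ : ZpExtension K p) (γ : absoluteGaloisGroup K) [Fact (κ.IsTopGenerator γ)]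
    (Sf : Finset (HeightOneSpectrum (𝓞 K)))
    (hp2 : 2 < p) (hX : ClassX3 W p) (hSG : SubGordTwo W p)
    (htw : ∀ (V : WeierstrassCurve ℚ) [V.IsElliptic] [V.IsGloballyMinimal] (C : VariableChange ℚ),
      GoodOrd V p → C • V.quadraticTwist ((-1 : ℚ) ^ (p / 2) * p) = W → ¬ (p : ℤ) ∣ V.frobeniusTrace p - 1)
    (hK : IsImaginaryQuadratic K) (hH : SatisfiesHeegnerHypothesis (W.conductorNorm ℤ) K)
    (hsplit : ((Ideal.span {(p : ℤ)}).primesOver (𝓞 K)).ncard = 2)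
    (hv : ((p : ℕ) : 𝓞 K) ∈ v.asIdeal) (hvbar : ((p : ℕ) : 𝓞 K) ∈ vbar.asIdeal) (hne : vbar ≠ v) (hκ : κ.IsAnticyclotomic)
    (hSf : ∀ w : HeightOneSpectrum (𝓞 K), w ∈ Sf ↔
      (((W.conductorNorm ℤ : ℤ) : 𝓞 K) ∈ w.asIdeal ∧ ((p : ℕ) : 𝓞 K) ∉ w.asIdeal))
    (θsub θquot : FramedGaloisRep K (padicCoeffIntegers (∅ : Set (PadicAlgCl p))) 1)
    (hpair : IsResidualPairOver (W.baseChange K) p θsub θquot)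
    (Dsub : GrDualData κ (charModule (∅ : Set (PadicAlgCl p)) θsub) vbar (↑Sf : Set (HeightOneSpectrum (𝓞 K))) γ)
    (Dquot : GrDualData κ (charModule (∅ : Set (PadicAlgCl p)) θquot) vbar (↑Sf : Set (HeightOneSpectrum (𝓞 K))) γ) :
    lambdaInvariant p (XAc (W.baseChange K) p κ vbar (↑Sf : Set (HeightOneSpectrum (𝓞 K))) γ) =
      lambdaInvariant p Dsub.X + lambdaInvariant p Dquot.X :=
  lambdaInvariant_xAc_eq_add_of_nonAnomalous_of_facts hprop125 hfact hlift hlocal h411 h41 h42 h32 W K vbar κ γ Sf hp2 hX.1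
    hK hH hsplit hv hvbar hne hκ hSf (hna_card_of_subGordTwo_of_forall_twist W hp2 hX hSG htw) θsub θquot hpair Dsub Dquot

/-! ### §5 The door's PRIMITIVE dual: `λ(X_ac^∅) + corank = λ_sub + λ_quot` — generic non-anomalous form and the cell -/

/-- **Generic (reduction-type-free) form of B2 §5:** at every Eisenstein Heegner datum with the non-anomalous clause `hna` (every
order-`p` subgroup), `2 < p = v v̄`: `X_ac^∅(E_K)` f.g., `Λ`-torsion, `μ = 0`, and `λ(X_ac^∅(E_K)) + corank_{ℤ_p}(Sel_{v̄}^{Sf}/Sel_{v̄}^∅)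
= λ(Dsub.X) + λ(Dquot.X)` for every residual pair and all strict dual data at `Sf`, modulo the eight published facts — B2 §3/§4
(`_of_nonAnomalous`) composed with the `λ`-shift `XAcImprimitiveLambdaShift.lambdaInvariant_eq_add_zpCorank_of_muInvariant_eq_zero`.
[cite: KellerYin2024, Thm. 1.4.1 and proof of Thm. 1.5.1 (arXiv:2402.12781v2 TeX L1087–1098, L1358–1360)]
[cite: CastellaGrossiLeeSkinner2022, §1.2 Prop. 1.2.5, Prop. 14, Cor. 1.2.6, §1.4, proof of Thm. 1.5.1]
[cite: GreenbergVatsal2000, §2 Cor. (2.3) and p. 21] [cite: Greenberg2016Selmer, Prop. 4.1.1 (c)] [cite: Greenberg2006, Props. 3.2, 4.1, 4.2] -/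
theorem lambdaInvariant_xAc_empty_add_zpCorank_eq_of_nonAnomalous_of_facts
    (hprop125 : prop125_characterGrSelmerDual_torsion_muZero_dim) (hfact : prop14_residualCharacterSelmer_finite)
    (hlift : cor126_residualCharacter_globalLift) (hlocal : cor126_residualCharacter_localSurjective)
    (h411 : prop411_selmer_isAlmostDivisible) (h41 : prop41_globalEulerPoincareCorank)
    (h42 : prop42_localEulerPoincareCorank) (h32 : prop32_cohomology_isCofinitelyGenerated)
    (W : WeierstrassCurve ℚ) [W.IsElliptic] [W.IsGloballyMinimal]
    (K : Type) [Field K] [NumberField K] {v : HeightOneSpectrum (𝓞 K)} (vbar : HeightOneSpectrum (𝓞 K))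
    (κ : ZpExtension K p) (γ : absoluteGaloisGroup K) [Fact (κ.IsTopGenerator γ)]
    (Sf : Finset (HeightOneSpectrum (𝓞 K)))
    (hp2 : 2 < p) (hred : Red W p)
    (hK : IsImaginaryQuadratic K) (hH : SatisfiesHeegnerHypothesis (W.conductorNorm ℤ) K)
    (hsplit : ((Ideal.span {(p : ℤ)}).primesOver (𝓞 K)).ncard = 2)
    (hv : ((p : ℕ) : 𝓞 K) ∈ v.asIdeal) (hvbar : ((p : ℕ) : 𝓞 K) ∈ vbar.asIdeal) (hne : vbar ≠ v) (hκ : κ.IsAnticyclotomic)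
    (hSf : ∀ w : HeightOneSpectrum (𝓞 K), w ∈ Sf ↔
      (((W.conductorNorm ℤ : ℤ) : 𝓞 K) ∈ w.asIdeal ∧ ((p : ℕ) : 𝓞 K) ∉ w.asIdeal))
    (hna : ∀ (v : HeightOneSpectrum (𝓞 ℚ)), ((p : ℕ) : 𝓞 ℚ) ∈ v.asIdeal →
      ∀ (Φ : AddSubgroup (geomTorsion W (p : ℤ))), Nat.card Φ = p →
      ∀ 𝔓 ∈ v.primesAbove,
        (¬ ∀ g ∈ 𝔓.decompositionSubgroup (absoluteGaloisGroup ℚ), ∀ P ∈ Φ, g • P = P) ∧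
          (¬ ∀ g ∈ 𝔓.decompositionSubgroup (absoluteGaloisGroup ℚ),
            ∀ P : geomTorsion W (p : ℤ), g • P - P ∈ Φ))
    (θsub θquot : FramedGaloisRep K (padicCoeffIntegers (∅ : Set (PadicAlgCl p))) 1)
    (hpair : IsResidualPairOver (W.baseChange K) p θsub θquot)
    (Dsub : GrDualData κ (charModule (∅ : Set (PadicAlgCl p)) θsub) vbar (↑Sf : Set (HeightOneSpectrum (𝓞 K))) γ)
    (Dquot : GrDualData κ (charModule (∅ : Set (PadicAlgCl p)) θquot) vbar (↑Sf : Set (HeightOneSpectrum (𝓞 K))) γ) :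
    Module.Finite (IwasawaAlgebra p) (XAc (W.baseChange K) p κ vbar (∅ : Set (HeightOneSpectrum (𝓞 K))) γ) ∧
      Module.IsTorsion (IwasawaAlgebra p) (XAc (W.baseChange K) p κ vbar (∅ : Set (HeightOneSpectrum (𝓞 K))) γ) ∧
      muInvariant p (XAc (W.baseChange K) p κ vbar (∅ : Set (HeightOneSpectrum (𝓞 K))) γ) = 0 ∧
      lambdaInvariant p (XAc (W.baseChange K) p κ vbar (∅ : Set (HeightOneSpectrum (𝓞 K))) γ) +
          zpCorank (↥(selmerAc (W.baseChange K) p κ vbar (↑Sf : Set (HeightOneSpectrum (𝓞 K)))) ⧸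
            (selmerAc (W.baseChange K) p κ vbar (∅ : Set (HeightOneSpectrum (𝓞 K)))).addSubgroupOf
              (selmerAc (W.baseChange K) p κ vbar (↑Sf : Set (HeightOneSpectrum (𝓞 K))))) p =
        lambdaInvariant p Dsub.X + lambdaInvariant p Dquot.X := by
  haveI hEK : (W.baseChange K).IsElliptic := inferInstanceAs (W.map (algebraMap ℚ K)).IsElliptic
  obtain ⟨hXfin, hXtor, hμ⟩ := xAc_moduleFinite_isTorsion_muInvariant_of_prop14_of_nonAnomalous hfact W K vbar κ γ Sf hp2 hred hK
    hH hsplit hvbar hκ hSf hna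
  haveI := hXfin
  obtain ⟨hfin₀, htor₀, hμ₀, -, hshift⟩ :=
    XAcImprimitiveLambdaShift.lambdaInvariant_eq_add_zpCorank_of_muInvariant_eq_zero (W.baseChange K) p κ vbar γ
      (Set.empty_subset (↑Sf : Set (HeightOneSpectrum (𝓞 K)))) hXtor hμ
  have heq := lambdaInvariant_xAc_eq_add_of_nonAnomalous_of_facts hprop125 hfact hlift hlocal h411 h41 h42 h32 W K vbar κ γ Sf
    hp2 hred hK hH hsplit hv hvbar hne hκ hSf hna θsub θquot hpair Dsub Dquot
  exact ⟨hfin₀, htor₀, hμ₀, by rw [← heq, hshift]⟩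

/-! ### §6 The door's PRIMITIVE dual against the primitive character duals, and the DOOR INEQUALITY — generic and cell forms -/

/-- **Generic (reduction-type-free) form of C §8:** at every Eisenstein Heegner datum with the non-anomalous clause, `2 < p = v v̄`:
`λ(X_ac^∅(E_K)) + corank_{ℤ_p}(Sel_{v̄}^{Sf}/Sel_{v̄}^∅) = λ(𝔛_{θsub}) + λ(𝔛_{θquot}) + Σ_{w∈Sf}(λ𝒫_w(θsub) + λ𝒫_w(θquot))` for every
residual pair and ALL primitive strict dual data, modulo the ten published facts (§5 + B2 §4 + C §7, all `_of_nonAnomalous`).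
[cite: KellerYin2024, Prop. 1.2.5, Thm. 1.4.1, proof of Thm. 1.5.1 (arXiv:2402.12781v2)]
[cite: CastellaGrossiLeeSkinner2022, §1.2 Prop. 1.2.5, Cor. 1.2.6, Prop. 14, §1.4, proof of Thm. 1.5.1]
[cite: GreenbergVatsal2000, §2 Cor. (2.3), Prop. (2.4) and p. 21] [cite: Greenberg2016Selmer, Props. 2.6.3, 4.1.1] [cite: Greenberg2006, Props. 3.2, 4.1, 4.2, §5 A] -/
theorem lambdaInvariant_xAc_empty_add_zpCorank_eq_add_add_sum_of_nonAnomalous_of_facts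
    (hprop125 : prop125_characterGrSelmerDual_torsion_muZero_dim) (hfact : prop14_residualCharacterSelmer_finite)
    (hlift : cor126_residualCharacter_globalLift) (hlocal : cor126_residualCharacter_localSurjective)
    (h411 : prop411_selmer_isAlmostDivisible) (h263 : prop263_sur_of_crk) (h41 : prop41_globalEulerPoincareCorank)
    (h42 : prop42_localEulerPoincareCorank) (h5A : sec5A_localH2_subsingleton_of_LOC1)
    (h32 : prop32_cohomology_isCofinitelyGenerated)
    (W : WeierstrassCurve ℚ) [W.IsElliptic] [W.IsGloballyMinimal]
    (K : Type) [Field K] [NumberField K] {v : HeightOneSpectrum (𝓞 K)} (vbar : HeightOneSpectrum (𝓞 K))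
    (κ : ZpExtension K p) (γ : absoluteGaloisGroup K) [hγ : Fact (κ.IsTopGenerator γ)]
    (Sf : Finset (HeightOneSpectrum (𝓞 K)))
    (hp2 : 2 < p) (hred : Red W p)
    (hK : IsImaginaryQuadratic K) (hH : SatisfiesHeegnerHypothesis (W.conductorNorm ℤ) K)
    (hsplit : ((Ideal.span {(p : ℤ)}).primesOver (𝓞 K)).ncard = 2)
    (hv : ((p : ℕ) : 𝓞 K) ∈ v.asIdeal) (hvbar : ((p : ℕ) : 𝓞 K) ∈ vbar.asIdeal) (hne : vbar ≠ v) (hκ : κ.IsAnticyclotomic)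
    (hSf : ∀ w : HeightOneSpectrum (𝓞 K), w ∈ Sf ↔
      (((W.conductorNorm ℤ : ℤ) : 𝓞 K) ∈ w.asIdeal ∧ ((p : ℕ) : 𝓞 K) ∉ w.asIdeal))
    (hna : ∀ (v : HeightOneSpectrum (𝓞 ℚ)), ((p : ℕ) : 𝓞 ℚ) ∈ v.asIdeal →
      ∀ (Φ : AddSubgroup (geomTorsion W (p : ℤ))), Nat.card Φ = p →
      ∀ 𝔓 ∈ v.primesAbove,
        (¬ ∀ g ∈ 𝔓.decompositionSubgroup (absoluteGaloisGroup ℚ), ∀ P ∈ Φ, g • P = P) ∧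
          (¬ ∀ g ∈ 𝔓.decompositionSubgroup (absoluteGaloisGroup ℚ),
            ∀ P : geomTorsion W (p : ℤ), g • P - P ∈ Φ))
    (θsub θquot : FramedGaloisRep K (padicCoeffIntegers (∅ : Set (PadicAlgCl p))) 1)
    (hpair : IsResidualPairOver (W.baseChange K) p θsub θquot)
    (D0sub : GrDualData κ (charModule (∅ : Set (PadicAlgCl p)) θsub) vbar (∅ : Set (HeightOneSpectrum (𝓞 K))) γ)
    (D0quot : GrDualData κ (charModule (∅ : Set (PadicAlgCl p)) θquot) vbar (∅ : Set (HeightOneSpectrum (𝓞 K))) γ) :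
    lambdaInvariant p (XAc (W.baseChange K) p κ vbar (∅ : Set (HeightOneSpectrum (𝓞 K))) γ) +
        zpCorank (↥(selmerAc (W.baseChange K) p κ vbar (↑Sf : Set (HeightOneSpectrum (𝓞 K)))) ⧸
          (selmerAc (W.baseChange K) p κ vbar (∅ : Set (HeightOneSpectrum (𝓞 K)))).addSubgroupOf
            (selmerAc (W.baseChange K) p κ vbar (↑Sf : Set (HeightOneSpectrum (𝓞 K))))) p =
      lambdaInvariant p D0sub.X + lambdaInvariant p D0quot.X +
        ∑ w ∈ Sf, (charLocalLambda (∅ : Set (PadicAlgCl p)) κ θsub w + charLocalLambda (∅ : Set (PadicAlgCl p)) κ θquot w) := by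
  obtain ⟨Dsub⟩ := nonempty_grDualData_char (∅ : Set (PadicAlgCl p)) θsub κ vbar (↑Sf : Set (HeightOneSpectrum (𝓞 K))) hγ.out
  obtain ⟨Dquot⟩ := nonempty_grDualData_char (∅ : Set (PadicAlgCl p)) θquot κ vbar (↑Sf : Set (HeightOneSpectrum (𝓞 K))) hγ.out
  obtain ⟨-, -, -, hshift⟩ := lambdaInvariant_xAc_empty_add_zpCorank_eq_of_nonAnomalous_of_facts hprop125 hfact hlift hlocal h411
    h41 h42 h32 W K vbar κ γ Sf hp2 hred hK hH hsplit hv hvbar hne hκ hSf hna θsub θquot hpair Dsub Dquot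
  have himp := lambdaInvariant_xAc_eq_add_of_nonAnomalous_of_facts hprop125 hfact hlift hlocal h411 h41 h42 h32 W K vbar κ γ Sf
    hp2 hred hK hH hsplit hv hvbar hne hκ hSf hna θsub θquot hpair Dsub Dquot
  have hchar := lambdaInvariant_xAc_eq_add_add_sum_of_nonAnomalous_of_facts hprop125 hfact hlift hlocal h411 h263 h41 h42 h5A h32
    W K vbar κ γ Sf hp2 hred hK hH hsplit hv hvbar hne hκ hSf hna θsub θquot hpair D0sub D0quot
  rw [hshift, ← himp, hchar]

/-- **Generic (reduction-type-free) form of C §9 — THE DOOR INEQUALITY:** at every Eisenstein Heegner datum with the non-anomalous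
clause, `2 < p = v v̄`: `λ(𝔛_{θsub}) + λ(𝔛_{θquot}) + Σ_{w∈Sf}(λ𝒫_w(θsub) + λ𝒫_w(θquot)) ≤ λ(X_ac^∅(E_K)) + Σ_{w∈Sf} λ𝒫_w(E_K)` for
every residual pair and ALL primitive strict dual data, modulo the ten published facts — the form above plus cell `bsd-eis`'s
UNCONDITIONAL `corank ≤ Σ λ𝒫_w(E_K)` (`FSideCorankLeOffP.zpCorank_selmerAc_quotient_le_sum_curveLocalLambda_of_offP_iff`).
[cite: GreenbergVatsal2000, §2 Cor. (2.3), Prop. (2.4) pp. 22–23] [cite: KellerYin2024, Prop. 1.2.5, Thm. 1.4.1, §1.5 (arXiv:2402.12781v2)]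
[cite: CastellaGrossiLeeSkinner2022, §1.2 Prop. 1.2.5, Cor. 1.2.6, Prop. 14, §1.4, (eq:1)] [cite: SilvermanATAEC1994, Ch. V Thm. 5.3, Cor. 5.4] -/
theorem add_add_sum_le_lambdaInvariant_xAc_empty_add_sum_curveLocalLambda_of_nonAnomalous_of_facts
    (hprop125 : prop125_characterGrSelmerDual_torsion_muZero_dim) (hfact : prop14_residualCharacterSelmer_finite)
    (hlift : cor126_residualCharacter_globalLift) (hlocal : cor126_residualCharacter_localSurjective)
    (h411 : prop411_selmer_isAlmostDivisible) (h263 : prop263_sur_of_crk) (h41 : prop41_globalEulerPoincareCorank)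
    (h42 : prop42_localEulerPoincareCorank) (h5A : sec5A_localH2_subsingleton_of_LOC1)
    (h32 : prop32_cohomology_isCofinitelyGenerated)
    (W : WeierstrassCurve ℚ) [W.IsElliptic] [W.IsGloballyMinimal]
    (K : Type) [Field K] [NumberField K] {v : HeightOneSpectrum (𝓞 K)} (vbar : HeightOneSpectrum (𝓞 K))
    (κ : ZpExtension K p) (γ : absoluteGaloisGroup K) [hγ : Fact (κ.IsTopGenerator γ)]
    (Sf : Finset (HeightOneSpectrum (𝓞 K)))
    (hp2 : 2 < p) (hred : Red W p)
    (hK : IsImaginaryQuadratic K) (hH : SatisfiesHeegnerHypothesis (W.conductorNorm ℤ) K)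
    (hsplit : ((Ideal.span {(p : ℤ)}).primesOver (𝓞 K)).ncard = 2)
    (hv : ((p : ℕ) : 𝓞 K) ∈ v.asIdeal) (hvbar : ((p : ℕ) : 𝓞 K) ∈ vbar.asIdeal) (hne : vbar ≠ v) (hκ : κ.IsAnticyclotomic)
    (hSf : ∀ w : HeightOneSpectrum (𝓞 K), w ∈ Sf ↔
      (((W.conductorNorm ℤ : ℤ) : 𝓞 K) ∈ w.asIdeal ∧ ((p : ℕ) : 𝓞 K) ∉ w.asIdeal))
    (hna : ∀ (v : HeightOneSpectrum (𝓞 ℚ)), ((p : ℕ) : 𝓞 ℚ) ∈ v.asIdeal →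
      ∀ (Φ : AddSubgroup (geomTorsion W (p : ℤ))), Nat.card Φ = p →
      ∀ 𝔓 ∈ v.primesAbove,
        (¬ ∀ g ∈ 𝔓.decompositionSubgroup (absoluteGaloisGroup ℚ), ∀ P ∈ Φ, g • P = P) ∧
          (¬ ∀ g ∈ 𝔓.decompositionSubgroup (absoluteGaloisGroup ℚ),
            ∀ P : geomTorsion W (p : ℤ), g • P - P ∈ Φ))
    (θsub θquot : FramedGaloisRep K (padicCoeffIntegers (∅ : Set (PadicAlgCl p))) 1)
    (hpair : IsResidualPairOver (W.baseChange K) p θsub θquot)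
    (D0sub : GrDualData κ (charModule (∅ : Set (PadicAlgCl p)) θsub) vbar (∅ : Set (HeightOneSpectrum (𝓞 K))) γ)
    (D0quot : GrDualData κ (charModule (∅ : Set (PadicAlgCl p)) θquot) vbar (∅ : Set (HeightOneSpectrum (𝓞 K))) γ) :
    lambdaInvariant p D0sub.X + lambdaInvariant p D0quot.X +
        ∑ w ∈ Sf, (charLocalLambda (∅ : Set (PadicAlgCl p)) κ θsub w + charLocalLambda (∅ : Set (PadicAlgCl p)) κ θquot w) ≤
      lambdaInvariant p (XAc (W.baseChange K) p κ vbar (∅ : Set (HeightOneSpectrum (𝓞 K))) γ) +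
        ∑ w ∈ Sf, curveLocalLambda κ (W.baseChange K) w := by
  have heq := lambdaInvariant_xAc_empty_add_zpCorank_eq_add_add_sum_of_nonAnomalous_of_facts hprop125 hfact hlift hlocal h411
    h263 h41 h42 h5A h32 W K vbar κ γ Sf hp2 hred hK hH hsplit hv hvbar hne hκ hSf hna θsub θquot hpair D0sub D0quot
  have hle := FSideCorankLeOffP.zpCorank_selmerAc_quotient_le_sum_curveLocalLambda_of_offP_iff W hp2 hK hH κ hκ hγ.out
    vbar Sf hSf
  rw [← heq]
  exact Nat.add_le_add_left hle _

/-- **THE DOOR INEQUALITY ON THE (G-ord, `e = 2`) CELL WITH `NAT(W, p)`, every odd `p` — in particular at `p = 3` for the 686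
non-anomalous pairs:** `λ(𝔛_{θsub}) + λ(𝔛_{θquot}) + Σ_{w∈Sf}(λ𝒫_w(θsub) + λ𝒫_w(θquot)) ≤ λ(X_ac^∅(E_K)) + Σ_{w∈Sf} λ𝒫_w(E_K)` for every
residual pair of `E_K[p]` and ALL primitive strict dual data, modulo the ten published facts.  This is the algebraic side of
Keller–Yin 2410.23241 Thm. 3.5.1's "`λ(𝔛) = λ(𝓛_ε)`" in the one-sided form the door's hinge consumes (`KYBranchHalvesLambdaLe`), now
beyond `p ≥ 5`.
[cite: KellerYin2024b, Thm. 3.5.1 first sentence "λ(𝔛) = λ(𝓛_ε)" (arXiv:2410.23241 p. 20) (preprint; algebraic side derived for odd p under NAT)]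
[cite: GreenbergVatsal2000, §2 Cor. (2.3), Prop. (2.4)] [cite: CastellaGrossiLeeSkinner2022, §1.2 Prop. 1.2.5, Cor. 1.2.6, Prop. 14, §1.4]
[cite: Greenberg2016Selmer, Props. 2.6.3, 4.1.1] [cite: Greenberg2006, Props. 3.2, 4.1, 4.2, §5 A] -/
theorem add_add_sum_le_lambdaInvariant_xAc_empty_add_sum_curveLocalLambda_of_subGordTwo_of_forall_twist_of_facts
    (hprop125 : prop125_characterGrSelmerDual_torsion_muZero_dim) (hfact : prop14_residualCharacterSelmer_finite)
    (hlift : cor126_residualCharacter_globalLift) (hlocal : cor126_residualCharacter_localSurjective)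
    (h411 : prop411_selmer_isAlmostDivisible) (h263 : prop263_sur_of_crk) (h41 : prop41_globalEulerPoincareCorank)
    (h42 : prop42_localEulerPoincareCorank) (h5A : sec5A_localH2_subsingleton_of_LOC1)
    (h32 : prop32_cohomology_isCofinitelyGenerated)
    (W : WeierstrassCurve ℚ) [W.IsElliptic] [W.IsGloballyMinimal]
    (K : Type) [Field K] [NumberField K] {v : HeightOneSpectrum (𝓞 K)} (vbar : HeightOneSpectrum (𝓞 K))
    (κ : ZpExtension K p) (γ : absoluteGaloisGroup K) [hγ : Fact (κ.IsTopGenerator γ)]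
    (Sf : Finset (HeightOneSpectrum (𝓞 K)))
    (hp2 : 2 < p) (hX : ClassX3 W p) (hSG : SubGordTwo W p)
    (htw : ∀ (V : WeierstrassCurve ℚ) [V.IsElliptic] [V.IsGloballyMinimal] (C : VariableChange ℚ),
      GoodOrd V p → C • V.quadraticTwist ((-1 : ℚ) ^ (p / 2) * p) = W → ¬ (p : ℤ) ∣ V.frobeniusTrace p - 1)
    (hK : IsImaginaryQuadratic K) (hH : SatisfiesHeegnerHypothesis (W.conductorNorm ℤ) K)
    (hsplit : ((Ideal.span {(p : ℤ)}).primesOver (𝓞 K)).ncard = 2)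
    (hv : ((p : ℕ) : 𝓞 K) ∈ v.asIdeal) (hvbar : ((p : ℕ) : 𝓞 K) ∈ vbar.asIdeal) (hne : vbar ≠ v) (hκ : κ.IsAnticyclotomic)
    (hSf : ∀ w : HeightOneSpectrum (𝓞 K), w ∈ Sf ↔
      (((W.conductorNorm ℤ : ℤ) : 𝓞 K) ∈ w.asIdeal ∧ ((p : ℕ) : 𝓞 K) ∉ w.asIdeal))
    (θsub θquot : FramedGaloisRep K (padicCoeffIntegers (∅ : Set (PadicAlgCl p))) 1)
    (hpair : IsResidualPairOver (W.baseChange K) p θsub θquot)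
    (D0sub : GrDualData κ (charModule (∅ : Set (PadicAlgCl p)) θsub) vbar (∅ : Set (HeightOneSpectrum (𝓞 K))) γ)
    (D0quot : GrDualData κ (charModule (∅ : Set (PadicAlgCl p)) θquot) vbar (∅ : Set (HeightOneSpectrum (𝓞 K))) γ) :
    lambdaInvariant p D0sub.X + lambdaInvariant p D0quot.X +
        ∑ w ∈ Sf, (charLocalLambda (∅ : Set (PadicAlgCl p)) κ θsub w + charLocalLambda (∅ : Set (PadicAlgCl p)) κ θquot w) ≤
      lambdaInvariant p (XAc (W.baseChange K) p κ vbar (∅ : Set (HeightOneSpectrum (𝓞 K))) γ) +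
        ∑ w ∈ Sf, curveLocalLambda κ (W.baseChange K) w :=
  add_add_sum_le_lambdaInvariant_xAc_empty_add_sum_curveLocalLambda_of_nonAnomalous_of_facts hprop125 hfact hlift hlocal h411
    h263 h41 h42 h5A h32 W K vbar κ γ Sf hp2 hX.1 hK hH hsplit hv hvbar hne hκ hSf
    (hna_card_of_subGordTwo_of_forall_twist W hp2 hX hSG htw) θsub θquot hpair D0sub D0quot

end Summit.BirchSwinnertonDyer.BirchSwinnertonDyer.Theorems.SchneiderFreeAdditiveX3.KYNonAnomalousTwist

end
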